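import Summits.Ventures.PercRepro.S2IndepMultiplicity

/-!
# PercRepro — S2: THE INDEPENDENT `j`-SUBSETS OF A SET AND THE MULTIPLICITY `j₀·(C(ν, j₀) − (2^{j₀−1} − j₀)·C(ν, j₀−1))`
(p4, gen 17; paper proofs/P4-gen17.md §5; THEOREM M's count; a feeder for the S4 rows `q ≥ 10`, owner p9)

Under the flat bound `|Y| + 1 ≤ 2^{r(Y)}` (`hsp`, the `e`-free core's `ncard_add_one_le_two_pow_of_eRk_le`) a dependent
`j`-subset `T` of `X` is a `(j−1)`-subset `T′ ⊆ T` (containing a basis of `T`) plus one point of `cl(T′) ∩ X` outside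
`T′` — at most `2^{j−1} − 1 − (j − 1)` choices — so `#{dependent j-subsets} ≤ (2^{j−1} − j)·C(|X|, j − 1)`
(`card_filter_dep_powersetCard_le`) and `#{independent j-subsets} ≥ C(|X|, j) − (2^{j−1} − j)·C(|X|, j − 1)`
(`card_filter_indep_powersetCard_ge`). With THEOREM M (`card_spanF_ge_mul_card_indep`):
`card_spanF_ge_indep`: a rank-`q` set of nullity `ν` has `≥ j₀·(C(ν, j₀) − (2^{j₀−1} − j₀)·C(ν, j₀ − 1))` spanning
`(q+1)`-subsets, for every `j₀ ≥ 1` (natural subtraction). Axioms: standard.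
-/

open scoped Matroid

namespace PercRepro

namespace S2

open Set

variable {α : Type} {M : Matroid α}

open scoped Classical in
/-- **THE DEPENDENT `j`-SUBSETS**: under `|Y| + 1 ≤ 2^{r(Y)}`, at most `(2^{j−1} − j)·C(|X|, j − 1)` of the `j`-subsets
of `X ⊆ E` are dependent (each is a `(j−1)`-subset plus one further point of its closure). -/
theorem card_filter_dep_powersetCard_le [M.Finite]
    (hsp : ∀ k : ℕ, ∀ Y ⊆ M.E, M.eRk Y ≤ k → Y.ncard + 1 ≤ 2 ^ k)
    {X : Finset α} (hXE : (X : Set α) ⊆ M.E) (j : ℕ) (hj : 1 ≤ j) :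
    ((X.powersetCard j).filter (fun T : Finset α => ¬ M.Indep (T : Set α))).card ≤
      (2 ^ (j - 1) - j) * X.card.choose (j - 1) := by
  set Sg : Finset (Σ _ : Finset α, α) :=
    (X.powersetCard (j - 1)).sigma (fun T' => (X.filter (fun x => x ∈ M.closure (T' : Set α))) \ T') with hSg
  -- the size of the target family
  have hcard : Sg.card ≤ (2 ^ (j - 1) - j) * X.card.choose (j - 1) := by
    rw [hSg, Finset.card_sigma]
    have hper : ∀ T' ∈ X.powersetCard (j - 1),
        ((X.filter (fun x => x ∈ M.closure (T' : Set α))) \ T').card ≤ 2 ^ (j - 1) - j := by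
      intro T' hT'
      rw [Finset.mem_powersetCard] at hT'
      have hT'E : (T' : Set α) ⊆ M.E := (Finset.coe_subset.2 hT'.1).trans hXE
      have hsub : T' ⊆ X.filter (fun x => x ∈ M.closure (T' : Set α)) := by
        intro x hx
        rw [Finset.mem_filter]
        exact ⟨hT'.1 hx, M.subset_closure _ hT'E hx⟩
      rw [Finset.card_sdiff_of_subset hsub, hT'.2]
      have hF : (X.filter (fun x => x ∈ M.closure (T' : Set α))).card ≤ 2 ^ (j - 1) - 1 := by
        have h1 : ((X.filter (fun x => x ∈ M.closure (T' : Set α)) : Finset α) : Set α) ⊆ M.closure (T' : Set α) := by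
          intro x hx
          rw [Finset.mem_coe, Finset.mem_filter] at hx
          exact hx.2
        have h2 : (M.closure (T' : Set α)).ncard + 1 ≤ 2 ^ (j - 1) := by
          refine hsp (j - 1) _ (M.closure_subset_ground _) ?_
          rw [M.eRk_closure_eq]
          calc M.eRk (T' : Set α) ≤ (T' : Set α).encard := M.eRk_le_encard _
            _ = ((j - 1 : ℕ) : ℕ∞) := by rw [Set.encard_coe_eq_coe_finsetCard, hT'.2]
        have h3 := Set.ncard_le_ncard h1 (M.ground_finite.subset (M.closure_subset_ground _))
        rw [Set.ncard_coe_finset] at h3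
        omega
      omega
    calc ∑ T' ∈ X.powersetCard (j - 1), ((X.filter (fun x => x ∈ M.closure (T' : Set α))) \ T').card
        ≤ ∑ _T' ∈ X.powersetCard (j - 1), (2 ^ (j - 1) - j) := Finset.sum_le_sum hper
      _ = (2 ^ (j - 1) - j) * X.card.choose (j - 1) := by
          rw [Finset.sum_const, Finset.card_powersetCard, smul_eq_mul, mul_comm]
  -- the surjection `(T′, x) ↦ insert x T′` onto the dependent `j`-subsets
  have hsurj : Set.SurjOn (fun s : Σ _ : Finset α, α => insert s.2 s.1) (Sg : Set (Σ _ : Finset α, α))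
      (((X.powersetCard j).filter (fun T : Finset α => ¬ M.Indep (T : Set α))) :
        Set (Finset α)) := by
    intro T hT
    rw [Finset.mem_coe, Finset.mem_filter, Finset.mem_powersetCard] at hT
    obtain ⟨⟨hTX, hTcard⟩, hTdep⟩ := hT
    have hTE : (T : Set α) ⊆ M.E := (Finset.coe_subset.2 hTX).trans hXE
    -- a basis `T₀` of `T` has fewer than `j` elements
    obtain ⟨T₀, hT₀⟩ := M.exists_isBasis (T : Set α) hTE
    have hT₀fin : T₀.Finite := T.finite_toSet.subset hT₀.subset
    set T₀f : Finset α := hT₀fin.toFinset with hT₀fdef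
    have hT₀coe : (T₀f : Set α) = T₀ := Set.Finite.coe_toFinset _
    have hT₀T : T₀f ⊆ T := by
      intro x hx
      rw [hT₀fdef, Set.Finite.mem_toFinset] at hx
      exact_mod_cast hT₀.subset hx
    have hT₀card : T₀f.card ≤ j - 1 := by
      have h1 : T₀.encard < (T : Set α).encard := by
        rw [hT₀.encard_eq_eRk]
        have hne : M.eRk (T : Set α) ≠ (T : Set α).encard := fun h =>
          hTdep ((Matroid.indep_iff_eRk_eq_encard_of_finite T.finite_toSet).2 h)
        exact lt_of_le_of_ne (M.eRk_le_encard _) hne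
      rw [← hT₀coe, Set.encard_coe_eq_coe_finsetCard, Set.encard_coe_eq_coe_finsetCard, hTcard] at h1
      have h2 : T₀f.card < j := by exact_mod_cast h1
      omega
    -- extend it to a `(j−1)`-subset `T′ ⊆ T`, pick `x ∈ T ∖ T′`
    obtain ⟨T', hT₀T', hT'T, hT'card⟩ :=
      Finset.exists_subsuperset_card_eq hT₀T hT₀card (by rw [hTcard]; omega)
    have hex : (T \ T').Nonempty := by
      rw [← Finset.card_pos, Finset.card_sdiff_of_subset hT'T, hTcard, hT'card]
      omega
    obtain ⟨x, hx⟩ := hex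
    rw [Finset.mem_sdiff] at hx
    have hTcl : (T : Set α) ⊆ M.closure (T' : Set α) := by
      refine hT₀.subset_closure.trans (M.closure_subset_closure ?_)
      rw [← hT₀coe]
      exact_mod_cast hT₀T'
    refine ⟨⟨T', x⟩, ?_, ?_⟩
    · rw [Finset.mem_coe, hSg, Finset.mem_sigma, Finset.mem_powersetCard, Finset.mem_sdiff, Finset.mem_filter]
      exact ⟨⟨hT'T.trans hTX, hT'card⟩, ⟨hTX hx.1, hTcl (by exact_mod_cast hx.1)⟩, hx.2⟩
    · show insert x T' = T
      apply Finset.eq_of_subset_of_card_le (Finset.insert_subset hx.1 hT'T)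
      rw [Finset.card_insert_of_notMem hx.2, hT'card, hTcard]
      omega
  exact (Finset.card_le_card_of_surjOn _ hsurj).trans hcard

open scoped Classical in
/-- **THE INDEPENDENT `j`-SUBSETS**: `C(|X|, j) ≤ #{independent j-subsets of X} + (2^{j−1} − j)·C(|X|, j − 1)`. -/
theorem card_filter_indep_powersetCard_ge [M.Finite]
    (hsp : ∀ k : ℕ, ∀ Y ⊆ M.E, M.eRk Y ≤ k → Y.ncard + 1 ≤ 2 ^ k)
    {X : Finset α} (hXE : (X : Set α) ⊆ M.E) (j : ℕ) (hj : 1 ≤ j) :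
    X.card.choose j ≤ ((X.powersetCard j).filter (fun T : Finset α => M.Indep (T : Set α))).card +
      (2 ^ (j - 1) - j) * X.card.choose (j - 1) := by
  have h1 := Finset.card_filter_add_card_filter_not (s := X.powersetCard j) (fun T : Finset α => M.Indep (T : Set α))
  rw [Finset.card_powersetCard] at h1
  have h2 := card_filter_dep_powersetCard_le hsp hXE j hj
  have e : (X.powersetCard j).filter (fun T : Finset α => ¬ (fun T : Finset α => M.Indep (T : Set α)) T) =
      (X.powersetCard j).filter (fun T : Finset α => ¬ M.Indep (T : Set α)) :=
    Finset.filter_congr (fun _ _ => Iff.rfl)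
  rw [e] at h1
  omega

open scoped Classical in
/-- **THE MULTIPLICITY OF A RANK-`q` SET OF NULLITY `ν` THROUGH ITS INDEPENDENT `j₀`-SUBSETS OF EXTRAS**
(THEOREM M + the count): `j₀·(C(ν, j₀) − (2^{j₀−1} − j₀)·C(ν, j₀ − 1)) ≤ #spanF(B)` for every `j₀ ≥ 1`. -/
theorem card_spanF_ge_indep [M.Finite] (q : ℕ)
    (hsp : ∀ k : ℕ, ∀ Y ⊆ M.E, M.eRk Y ≤ k → Y.ncard + 1 ≤ 2 ^ k)
    {B : Finset α} (hBE : (B : Set α) ⊆ M.E) (hBq : M.eRk (B : Set α) = (q : ℕ∞)) (j₀ : ℕ) (hj : 1 ≤ j₀) :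
    j₀ * ((B.card - q).choose j₀ - (2 ^ (j₀ - 1) - j₀) * (B.card - q).choose (j₀ - 1)) ≤ (spanF M q B).card := by
  obtain ⟨I₀, hI₀⟩ := M.exists_isBasis (B : Set α) hBE
  have hI₀fin : I₀.Finite := B.finite_toSet.subset hI₀.subset
  set I : Finset α := hI₀fin.toFinset with hIdef
  have hIcoe : (I : Set α) = I₀ := Set.Finite.coe_toFinset _
  have hI : M.IsBasis (I : Set α) (B : Set α) := by rw [hIcoe]; exact hI₀
  have hIB : I ⊆ B := by exact_mod_cast hI.subset
  have hIcard : I.card = q := by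
    have h := hI.encard_eq_eRk
    rw [hBq, Set.encard_coe_eq_coe_finsetCard] at h
    exact_mod_cast h
  have hXcard : (B \ I).card = B.card - q := by rw [Finset.card_sdiff_of_subset hIB, hIcard]
  have hXE : ((B \ I : Finset α) : Set α) ⊆ M.E := (Finset.coe_subset.2 Finset.sdiff_subset).trans hBE
  have h1 := card_spanF_ge_mul_card_indep q hBE hBq hI j₀
  have h2 := card_filter_indep_powersetCard_ge hsp hXE j₀ hj
  rw [hXcard] at h2
  refine le_trans ?_ h1
  apply Nat.mul_le_mul_left
  omega

end S2

end PercRepro
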